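import Summits.Ventures.HodgeRepro2.WeilCoproduct

/-!
# Proposition A5.5 — the pairing identity in the coproduct model (A3, seat p5)

Continues `WeilCoproduct.lean`.  The «single surviving term» of T4-A3 Prop. A5.5 (Steps 3–4) is
proved by an INVARIANT: after the planes of a list `L` have been processed,
`cop(∏_{p ∈ L} F p) = w_L ⊗ E_{T_L} + (bad)`, where `F p = gen (p, s)` on the planes of `P₀` (the
factors of the Weil vector `w_σ`) and `F p = E p` on the other planes, `w_L` is the product of the
Weil factors met so far, `E_{T_L}` the product of the plane classes met so far, and the bad part is
spanned by tensors `x ⊗ y` whose right factor `y` is either HALF in a processed plane or a plane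
class `E_{T'}` with `T' ⊊ T_L` (`Bad`, `K`).  Lemma (V) (`WeilDetect`) kills every bad right factor
under `Ψ = ∫_B θ^{|P₀|} ∧ −`, and the main term gives the constant.

Main result: `pairing_identity` — for every class `z`,
`∫_{B×B} ((z ⊗ θ^{|P₀|}) · cop(θ^{|I|} ∧ w)) = |I|!·|P₀|!·c_𝒫·vol·∫_B (z ∧ w)` with `I = 𝒫 ∖ P₀`;
for `|I| = 8`, `|P₀| = 4`, `z = f_*(1_S)` this is `⟨y, θ^8 ∪ w_σ⟩ = 8!·4!·c_𝒫·vol·∫_S f^*w_σ`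
(T4-A3 Prop. A5.5), with `∫_{B×B} := ∫_B ⊗ ∫_B` (A5.2.0) and `m^* = cop` (A5.1.1) as the modelled
geometric inputs.
-/

open scoped TensorProduct

namespace Summit.Ventures.HodgeRepro2.WeilPairing

open Summit.Ventures.HodgeRepro2.WeilPlanes Summit.Ventures.HodgeRepro2.WeilIntegral
  Summit.Ventures.HodgeRepro2.WeilDetect Summit.Ventures.HodgeRepro2.WeilCoproduct

variable {ι : Type*} [DecidableEq ι]
/-! ## 3. The bad right factors and the invariant of A5.5 Steps 3–4 -/

/-- The "bad" right factors after the planes of `Q` have been processed, `T ⊆ Q` being the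
processed planes of `I`: monomials HALF in a processed plane `q` (a generator of `q` times a
monomial with no generator of `q`), and the plane classes `E_{T'}` with `T' ⊊ T`
(T4-A3 A5.5, Step 3: «half in a plane» / Lemma (V)). -/
def Bad (Q T : Finset ι) : Set (A ι) :=
  {y | ∃ q ∈ Q, ∃ c : Bool, ∃ l : List (Gen ι), (∀ j ∈ l, j.1 ≠ q) ∧ y = gen (q, c) * mono l} ∪
    {y | ∃ T' : Finset ι, T' ⊂ T ∧ y = ET T'}

/-- The subspace of `AA ι` spanned by the tensors `x ⊗ y` with `y` bad. -/
noncomputable def K (Q T : Finset ι) : Submodule ℂ (AA ι) :=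
  Submodule.span ℂ {Z | ∃ x y : A ι, y ∈ Bad Q T ∧ Z = (x ᵍ⊗ₜ[ℂ] y : AA ι)}

/-- Tensors with a bad right factor lie in `K`. -/
theorem tmul_mem_K {Q T : Finset ι} (x : A ι) {y : A ι} (hy : y ∈ Bad Q T) :
    (x ᵍ⊗ₜ[ℂ] y : AA ι) ∈ K Q T :=
  Submodule.subset_span ⟨x, y, hy, rfl⟩

/-- `Bad` is monotone in both arguments. -/
theorem Bad_mono {Q Q' T T' : Finset ι} (hQ : Q ⊆ Q') (hT : T ⊆ T') : Bad Q T ⊆ Bad Q' T' := by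
  rintro y (⟨q, hq, c, l, hl, rfl⟩ | ⟨T₀, hT₀, rfl⟩)
  · exact Or.inl ⟨q, hQ hq, c, l, hl, rfl⟩
  · exact Or.inr ⟨T₀, hT₀.trans_subset hT, rfl⟩

/-- `K` is monotone in both arguments. -/
theorem K_mono {Q Q' T T' : Finset ι} (hQ : Q ⊆ Q') (hT : T ⊆ T') : K Q T ≤ K Q' T' :=
  Submodule.span_mono fun _ ⟨x, y, hy, hZ⟩ => ⟨x, y, Bad_mono hQ hT hy, hZ⟩

/-- Left multiplication by `x' ⊗ 1` preserves `K`. -/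
theorem inl_mul_mem_K {Q T : Finset ι} (x' : A ι) {Z : AA ι} (hZ : Z ∈ K Q T) :
    inl x' * Z ∈ K Q T := by
  induction hZ using Submodule.span_induction with
  | mem Z hZ =>
    obtain ⟨x, y, hy, rfl⟩ := hZ
    rw [inl_mul_tmul]
    exact tmul_mem_K _ hy
  | zero => simp
  | add Z Z' _ _ hZ hZ' => rw [mul_add]; exact Submodule.add_mem _ hZ hZ'
  | smul a Z _ hZ => rw [mul_smul_comm]; exact Submodule.smul_mem _ _ hZ

/-- `E p = mono [a_p, b_p]`. -/
theorem E_eq_mono (p : ι) : E p = mono [(p, false), (p, true)] := by simp [E]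

/-- Left multiplication by `1 ⊗ E p` maps `K Q T` into `K (insert p Q) (insert p T)` when `p` is a
new plane. -/
theorem inr_E_mul_mem_K {Q T : Finset ι} (hTQ : T ⊆ Q) {p : ι} (hp : p ∉ Q) {Z : AA ι}
    (hZ : Z ∈ K Q T) : inr (E p) * Z ∈ K (insert p Q) (insert p T) := by
  induction hZ using Submodule.span_induction with
  | mem Z hZ =>
    obtain ⟨x, y, hy, rfl⟩ := hZ
    rw [inr_E_mul_tmul]
    apply tmul_mem_K
    rcases hy with ⟨q, hq, c, l, hl, rfl⟩ | ⟨T', hT', rfl⟩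
    · left
      refine ⟨q, Finset.mem_insert_of_mem hq, c, (p, false) :: (p, true) :: l, ?_, ?_⟩
      · intro j hj
        simp only [List.mem_cons] at hj
        rcases hj with rfl | rfl | hj
        · exact fun (h : p = q) => hp (h ▸ hq)
        · exact fun (h : p = q) => hp (h ▸ hq)
        · exact hl j hj
      · rw [← mul_assoc, (commute_E p (gen (q, c))).eq, mul_assoc, E_eq_mono, ← mono_append]
        rfl
    · right
      have hpT' : p ∉ T' := fun h => hp (hTQ (hT'.subset h))
      refine ⟨insert p T', ?_, (ET_insert hpT').symm⟩
      rw [Finset.ssubset_iff_subset_ne]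
      refine ⟨Finset.insert_subset_insert _ hT'.subset, fun h => ?_⟩
      have hpT : p ∉ T := fun h => hp (hTQ h)
      have : T' = T := by
        rw [← Finset.erase_insert hpT', h, Finset.erase_insert hpT]
      exact hT'.ne this
  | zero => simp
  | add Z Z' _ _ hZ hZ' => rw [mul_add]; exact Submodule.add_mem _ hZ hZ'
  | smul a Z _ hZ => rw [mul_smul_comm]; exact Submodule.smul_mem _ _ hZ

/-- `gen (p, c) * y` is bad (half in `p`) when `y` is bad for a set of planes not containing `p`. -/
theorem gen_mul_mem_K {Q T : Finset ι} (hTQ : T ⊆ Q) {p : ι} (hp : p ∉ Q) (c : Bool) {y : A ι}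
    (hy : y ∈ Bad Q T) (x' : A ι) :
    (x' ᵍ⊗ₜ[ℂ] (gen (p, c) * y) : AA ι) ∈ K (insert p Q) T := by
  rcases hy with ⟨q, hq, c', l, hl, rfl⟩ | ⟨T', hT', rfl⟩
  · -- `gen (p,c) * gen (q,c') * mono l = −(gen (q,c') * mono ((p,c) :: l))`
    have h : gen (p, c) * (gen (q, c') * mono l) = -(gen (q, c') * mono ((p, c) :: l)) := by
      rw [← mul_assoc, gen_mul_gen_swap, neg_mul, mul_assoc, mono_cons]
    rw [h, GradedTensorProduct.tmul, TensorProduct.tmul_neg, map_neg]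
    refine Submodule.neg_mem _ (tmul_mem_K _ (Or.inl ⟨q, Finset.mem_insert_of_mem hq, c', (p, c) :: l, ?_, rfl⟩))
    intro j hj
    simp only [List.mem_cons] at hj
    rcases hj with rfl | hj
    · exact fun (h : p = q) => hp (h ▸ hq)
    · exact hl j hj
  · refine tmul_mem_K _ (Or.inl ⟨p, Finset.mem_insert_self _ _, c, planeList T', ?_, by rw [ET_eq_mono]⟩)
    intro j hj h
    exact hp (hTQ (hT'.subset (h ▸ mem_planeList.mp hj)))

/-- Left multiplication by `1 ⊗ gen (p, c)` maps `K Q T` into `K (insert p Q) T` when `p` is new. -/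
theorem inr_gen_mul_mem_K {Q T : Finset ι} (hTQ : T ⊆ Q) {p : ι} (hp : p ∉ Q) (c : Bool) {Z : AA ι}
    (hZ : Z ∈ K Q T) : inr (gen (p, c)) * Z ∈ K (insert p Q) T := by
  induction hZ using Submodule.span_induction with
  | mem Z hZ =>
    obtain ⟨x, y, hy, rfl⟩ := hZ
    refine Submodule.span_le.mpr ?_ (inr_gen_mul_tmul_mem (p, c) x y)
    rintro _ ⟨x', rfl⟩
    exact gen_mul_mem_K hTQ hp c hy x'
  | zero => simp
  | add Z Z' _ _ hZ hZ' => rw [mul_add]; exact Submodule.add_mem _ hZ hZ'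
  | smul a Z _ hZ => rw [mul_smul_comm]; exact Submodule.smul_mem _ _ hZ

/-- `cop (E p)` maps `K Q T` into `K (insert p Q) (insert p T)` when `p` is new. -/
theorem cop_E_mul_mem_K {Q T : Finset ι} (hTQ : T ⊆ Q) {p : ι} (hp : p ∉ Q) {Z : AA ι}
    (hZ : Z ∈ K Q T) : cop (E p) * Z ∈ K (insert p Q) (insert p T) := by
  have hQ : Q ⊆ insert p Q := Finset.subset_insert _ _
  have hT : T ⊆ insert p T := Finset.subset_insert _ _
  have h1 : inr (E p) * Z ∈ K (insert p Q) (insert p T) := inr_E_mul_mem_K hTQ hp hZ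
  have h2 : inl (E p) * Z ∈ K (insert p Q) (insert p T) := inl_mul_mem_K _ (K_mono hQ hT hZ)
  have h3 : inl (gen (p, false)) * inr (gen (p, true)) * Z ∈ K (insert p Q) (insert p T) := by
    rw [mul_assoc]
    exact inl_mul_mem_K _ (K_mono (le_refl _) hT (inr_gen_mul_mem_K hTQ hp _ hZ))
  have h4 : inl (gen (p, true)) * inr (gen (p, false)) * Z ∈ K (insert p Q) (insert p T) := by
    rw [mul_assoc]
    exact inl_mul_mem_K _ (K_mono (le_refl _) hT (inr_gen_mul_mem_K hTQ hp _ hZ))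
  have : cop (E p) * Z = inr (E p) * Z + ((inl (E p) * Z + inl (gen (p, false)) * inr (gen (p, true)) * Z)
      - inl (gen (p, true)) * inr (gen (p, false)) * Z) := by
    rw [cop_E]
    simp only [add_mul, sub_mul]
  rw [this]
  exact Submodule.add_mem _ h1 (Submodule.sub_mem _ (Submodule.add_mem _ h2 h3) h4)

/-- `cop (gen (p, c))` maps `K Q T` into `K (insert p Q) T` when `p` is new. -/
theorem cop_gen_mul_mem_K {Q T : Finset ι} (hTQ : T ⊆ Q) {p : ι} (hp : p ∉ Q) (c : Bool) {Z : AA ι}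
    (hZ : Z ∈ K Q T) : cop (gen (p, c)) * Z ∈ K (insert p Q) T := by
  rw [cop_gen, add_mul]
  exact Submodule.add_mem _ (inl_mul_mem_K _ (K_mono (Finset.subset_insert _ _) (le_refl _) hZ))
    (inr_gen_mul_mem_K hTQ hp c hZ)

/-- The main term moves under `cop (E p)`: `cop (E p) (w ⊗ E_T) = w ⊗ E_{T ∪ {p}} + (bad)`. -/
theorem cop_E_mul_main {Q T : Finset ι} (hTQ : T ⊆ Q) {p : ι} (hp : p ∉ Q) (w : A ι) :
    cop (E p) * (w ᵍ⊗ₜ[ℂ] ET T : AA ι) - (w ᵍ⊗ₜ[ℂ] ET (insert p T) : AA ι) ∈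
      K (insert p Q) (insert p T) := by
  have hpT : p ∉ T := fun h => hp (hTQ h)
  have hTbad : ET T ∈ Bad (insert p Q) (insert p T) :=
    Or.inr ⟨T, Finset.ssubset_insert hpT, rfl⟩
  have hhalf : ∀ c : Bool, gen (p, c) * ET T ∈ Bad (insert p Q) (insert p T) := by
    intro c
    refine Or.inl ⟨p, Finset.mem_insert_self _ _, c, planeList T, ?_, by rw [ET_eq_mono]⟩
    intro j hj h
    exact hpT (h ▸ mem_planeList.mp hj)
  have h1 : inr (E p) * (w ᵍ⊗ₜ[ℂ] ET T : AA ι) = (w ᵍ⊗ₜ[ℂ] ET (insert p T) : AA ι) := by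
    rw [inr_E_mul_tmul, ET_insert hpT]
  have h2 : inl (E p) * (w ᵍ⊗ₜ[ℂ] ET T : AA ι) ∈ K (insert p Q) (insert p T) := by
    rw [inl_mul_tmul]
    exact tmul_mem_K _ hTbad
  have h3 : ∀ c c' : Bool,
      inl (gen (p, c)) * inr (gen (p, c')) * (w ᵍ⊗ₜ[ℂ] ET T : AA ι) ∈ K (insert p Q) (insert p T) := by
    intro c c'
    rw [mul_assoc]
    refine inl_mul_mem_K _ (Submodule.span_le.mpr ?_ (inr_gen_mul_tmul_mem (p, c') w (ET T)))
    rintro _ ⟨x', rfl⟩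
    exact tmul_mem_K _ (hhalf c')
  have : cop (E p) * (w ᵍ⊗ₜ[ℂ] ET T : AA ι) - (w ᵍ⊗ₜ[ℂ] ET (insert p T) : AA ι) =
      (inl (E p) * (w ᵍ⊗ₜ[ℂ] ET T : AA ι) +
        inl (gen (p, false)) * inr (gen (p, true)) * (w ᵍ⊗ₜ[ℂ] ET T : AA ι)) -
        inl (gen (p, true)) * inr (gen (p, false)) * (w ᵍ⊗ₜ[ℂ] ET T : AA ι) := by
    rw [cop_E, add_mul, h1, add_sub_cancel_left]
    simp only [add_mul, sub_mul]
  rw [this]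
  exact Submodule.sub_mem _ (Submodule.add_mem _ h2 (h3 _ _)) (h3 _ _)

/-- The main term moves under `cop (gen (p, c))`: `cop (gen) (w ⊗ E_T) = (gen ∧ w) ⊗ E_T + (bad)`. -/
theorem cop_gen_mul_main {Q T : Finset ι} (hTQ : T ⊆ Q) {p : ι} (hp : p ∉ Q) (c : Bool) (w : A ι) :
    cop (gen (p, c)) * (w ᵍ⊗ₜ[ℂ] ET T : AA ι) - ((gen (p, c) * w) ᵍ⊗ₜ[ℂ] ET T : AA ι) ∈
      K (insert p Q) T := by
  have hpT : p ∉ T := fun h => hp (hTQ h)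
  rw [cop_gen, add_mul, inl_mul_tmul, add_sub_cancel_left]
  refine Submodule.span_le.mpr ?_ (inr_gen_mul_tmul_mem (p, c) w (ET T))
  rintro _ ⟨x', rfl⟩
  refine tmul_mem_K _ (Or.inl ⟨p, Finset.mem_insert_self _ _, c, planeList T, ?_, by rw [ET_eq_mono]⟩)
  intro j hj h
  exact hpT (h ▸ mem_planeList.mp hj)


/-! ## 4. The invariant along the list of planes -/

/-- The plane factor: `gen (p, s)` on the planes of `P₀` (the factors of `w_σ`), `E p` elsewhere. -/
noncomputable def F (P₀ : Finset ι) (s : Bool) (p : ι) : A ι := if p ∈ P₀ then gen (p, s) else E p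

/-- The Weil factors of the planes of `L ∩ P₀`, in the order of `L`. -/
noncomputable def wL (P₀ : Finset ι) (s : Bool) (L : List ι) : A ι :=
  mono ((L.filter fun p => decide (p ∈ P₀)).map fun p => (p, s))

/-- The processed planes outside `P₀`. -/
def TL (P₀ : Finset ι) (L : List ι) : Finset ι := (L.filter fun p => decide (p ∉ P₀)).toFinset

/-- `TL P₀ L ⊆ L`. -/
theorem TL_subset (P₀ : Finset ι) (L : List ι) : TL P₀ L ⊆ L.toFinset := by
  intro p hp
  rw [TL, List.mem_toFinset, List.mem_filter] at hp
  exact List.mem_toFinset.mpr hp.1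

/-- `(1 : AA ι) = 1 ⊗ 1`. -/
theorem one_eq_tmul_one : (1 : AA ι) = ((1 : A ι) ᵍ⊗ₜ[ℂ] (1 : A ι) : AA ι) := rfl

/-- T4-A3 A5.5 Steps 3–4, the invariant: `cop(∏_{p ∈ L} F p) = w_L ⊗ E_{T_L} + (bad)`, where the bad
part lies in `K L.toFinset (T_L)`. -/
theorem cop_prod_sub_main_mem (P₀ : Finset ι) (s : Bool) (L : List ι) (hL : L.Nodup) :
    cop ((L.map (F P₀ s)).prod) - (wL P₀ s L ᵍ⊗ₜ[ℂ] ET (TL P₀ L) : AA ι) ∈ K L.toFinset (TL P₀ L) := by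
  induction L with
  | nil =>
    simp only [List.map_nil, List.prod_nil, map_one, wL, TL, List.filter_nil, List.toFinset_nil,
      mono_nil, ET_empty, one_eq_tmul_one, sub_self]
    exact Submodule.zero_mem _
  | cons p L ih =>
    rw [List.nodup_cons] at hL
    have hpL : p ∉ L.toFinset := fun h => hL.1 (List.mem_toFinset.mp h)
    have ih' := ih hL.2
    have hTQ : TL P₀ L ⊆ L.toFinset := TL_subset P₀ L
    rw [List.map_cons, List.prod_cons, map_mul, List.toFinset_cons]
    -- split `cop (prod)` into its main term and its bad part
    have hsplit : cop (F P₀ s p) * cop ((L.map (F P₀ s)).prod) =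
        cop (F P₀ s p) * (wL P₀ s L ᵍ⊗ₜ[ℂ] ET (TL P₀ L) : AA ι) +
          cop (F P₀ s p) * (cop ((L.map (F P₀ s)).prod) - (wL P₀ s L ᵍ⊗ₜ[ℂ] ET (TL P₀ L) : AA ι)) := by
      rw [mul_sub, add_sub_cancel]
    by_cases hp : p ∈ P₀
    · -- a Weil plane: the main term gains the factor `gen (p, s)` on the left
      have hw : wL P₀ s (p :: L) = gen (p, s) * wL P₀ s L := by
        simp [wL, hp]
      have hT : TL P₀ (p :: L) = TL P₀ L := by
        simp [TL, hp]
      have hF : F P₀ s p = gen (p, s) := if_pos hp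
      rw [hsplit, hw, hT, hF, add_sub_right_comm]
      exact Submodule.add_mem _ (cop_gen_mul_main hTQ hpL s _) (cop_gen_mul_mem_K hTQ hpL s ih')
    · -- a plane of `I`: the main term gains the factor `E p` on the right
      have hw : wL P₀ s (p :: L) = wL P₀ s L := by
        simp [wL, hp]
      have hT : TL P₀ (p :: L) = insert p (TL P₀ L) := by
        simp [TL, hp]
      have hF : F P₀ s p = E p := if_neg hp
      rw [hsplit, hw, hT, hF, add_sub_right_comm]
      exact Submodule.add_mem _ (cop_E_mul_main hTQ hpL _) (cop_E_mul_mem_K hTQ hpL ih')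

/-- `∏_{p ∈ L} F p = E_{T_L} ∧ w_L` (the plane classes are central). -/
theorem prod_map_F (P₀ : Finset ι) (s : Bool) (L : List ι) (hL : L.Nodup) :
    (L.map (F P₀ s)).prod = ET (TL P₀ L) * wL P₀ s L := by
  induction L with
  | nil => simp [wL, TL]
  | cons p L ih =>
    rw [List.nodup_cons] at hL
    rw [List.map_cons, List.prod_cons, ih hL.2]
    by_cases hp : p ∈ P₀
    · have hw : wL P₀ s (p :: L) = gen (p, s) * wL P₀ s L := by simp [wL, hp]
      have hT : TL P₀ (p :: L) = TL P₀ L := by simp [TL, hp]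
      rw [hw, hT, F, if_pos hp, ← mul_assoc, ← (commute_ET (TL P₀ L) (gen (p, s))).eq, mul_assoc]
    · have hw : wL P₀ s (p :: L) = wL P₀ s L := by simp [wL, hp]
      have hT : TL P₀ (p :: L) = insert p (TL P₀ L) := by simp [TL, hp]
      have hpT : p ∉ TL P₀ L := fun h => hL.1 (List.mem_toFinset.mp (TL_subset P₀ L h))
      rw [hw, hT, F, if_neg hp, ET_insert hpT, mul_assoc]

/-- The planes of `P₀ ∩ L` annihilate `w_L`. -/
theorem E_mul_wL (P₀ : Finset ι) (s : Bool) (L : List ι) {q : ι} (hq : q ∈ P₀) (hqL : q ∈ L) :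
    E q * wL P₀ s L = 0 := by
  apply E_mul_mono_of_mem (c := s)
  simp only [List.mem_map, List.mem_filter, decide_eq_true_eq]
  exact ⟨q, ⟨hqL, hq⟩, rfl⟩

/-! ## 5. The integral over `B × B` and the pairing identity (Prop. A5.5) -/

section Pairing

variable [Fintype ι]

/-- `∫_{B×B} := ∫_B ⊗ ∫_B` (T4-A3 (A5.2.0), here by construction). -/
noncomputable def II : AA ι →ₗ[ℂ] ℂ :=
  TensorProduct.lift ((LinearMap.mul ℂ ℂ).compl₁₂ integral integral) ∘ₗ
    (GradedTensorProduct.of ℂ (grading ι) (grading ι)).symm.toLinearMap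

/-- `∫_{B×B} (x ⊗ y) = ∫_B x · ∫_B y`. -/
theorem II_tmul (x y : A ι) : II (x ᵍ⊗ₜ[ℂ] y : AA ι) = integral x * integral y := by
  simp [II, GradedTensorProduct.tmul]

/-- `∫_{B×B} ((z ⊗ θ^r)(x ⊗ y)) = ∫_B (z x) · ∫_B (θ^r y)` (T4-A3 (A5.2.1)). -/
theorem II_pair_tmul (z : A ι) (c : ι → ℂ) (r : ℕ) (x y : A ι) :
    II (inl z * inr (theta c ^ r) * (x ᵍ⊗ₜ[ℂ] y : AA ι)) =
      integral (z * x) * integral (theta c ^ r * y) := by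
  rw [mul_assoc, inr_theta_pow_mul_tmul, inl_mul_tmul, II_tmul]

/-- The bad part contributes nothing: `∫_{B×B} ((z ⊗ θ^{|P₀|}) Z) = 0` for `Z ∈ K 𝒫 (𝒫 ∖ P₀)`
(Lemma (V) on the right factors). -/
theorem II_pair_K_eq_zero (P₀ : Finset ι) (z : A ι) (c : ι → ℂ) {Z : AA ι}
    (hZ : Z ∈ K (Finset.univ : Finset ι) (Finset.univ \ P₀)) :
    II (inl z * inr (theta c ^ P₀.card) * Z) = 0 := by
  induction hZ using Submodule.span_induction with
  | mem Z hZ =>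
    obtain ⟨x, y, hy, rfl⟩ := hZ
    rw [II_pair_tmul]
    refine mul_eq_zero_of_right _ ?_
    rcases hy with ⟨q, -, c', l, hl, rfl⟩ | ⟨T', hT', rfl⟩
    · rw [← mono_cons]
      refine integral_theta_pow_mul_mono_eq_zero_of_half c _ (List.mem_cons_self ..) ?_
      intro h
      simp only [List.mem_cons, Prod.mk.injEq] at h
      rcases h with ⟨-, h⟩ | h
      · cases c' <;> simp at h
      · exact hl _ h rfl
    · rw [integral_theta_pow_mul_ET, if_neg]
      intro h
      have h1 : T'.card < (Finset.univ \ P₀).card := Finset.card_lt_card hT'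
      have h2 : ((Finset.univ : Finset ι) \ T').card = Finset.univ.card - T'.card :=
        Finset.card_sdiff_of_subset (Finset.subset_univ _)
      have h3 : ((Finset.univ : Finset ι) \ P₀).card = Finset.univ.card - P₀.card :=
        Finset.card_sdiff_of_subset (Finset.subset_univ _)
      have h4 : P₀.card ≤ Finset.univ.card := Finset.card_le_univ _
      have h5 : T'.card ≤ Finset.univ.card := Finset.card_le_univ _
      omega
  | zero => simp
  | add Z Z' _ _ hZ hZ' => rw [mul_add, map_add, hZ, hZ', add_zero]
  | smul a Z _ hZ => rw [mul_smul_comm, map_smul, hZ, smul_zero]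

/-- `T_L = 𝒫 ∖ P₀` for the full list of planes. -/
theorem TL_univ (P₀ : Finset ι) : TL P₀ (Finset.univ : Finset ι).toList = Finset.univ \ P₀ := by
  ext p
  simp [TL]

/-- T4-A3 PROPOSITION A5.5 (the pairing identity), in the model: for every class `z`,
`∫_{B×B} ((z ⊗ θ^{|P₀|}) · cop(θ^{|I|} ∧ w)) = |I|!·|P₀|!·c_𝒫·vol·∫_B (z ∧ w)`, where `I = 𝒫 ∖ P₀`,
`w = w_L` is the Weil vector of `P₀` (its factors in the order of the fixed enumeration of the
planes) and `c_𝒫 = ∏_p c_p`.  With `|I| = 8`, `|P₀| = 4` and `z = f_*(1_S)` this is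
`⟨y, θ^8 ∪ w_σ⟩ = 8!·4!·c_𝒫·vol·∫_S f^*w_σ`. -/
theorem pairing_identity (P₀ : Finset ι) (s : Bool) (c : ι → ℂ) (z : A ι) :
    II (inl z * inr (theta c ^ P₀.card) *
        cop (theta c ^ (Finset.univ \ P₀).card * wL P₀ s (Finset.univ : Finset ι).toList)) =
      (((Finset.univ \ P₀).card.factorial : ℂ) * (P₀.card.factorial : ℂ) * (∏ p, c p) * vol ι) *
        integral (z * wL P₀ s (Finset.univ : Finset ι).toList) := by
  set L := (Finset.univ : Finset ι).toList with hL
  set w := wL P₀ s L with hw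
  have hLnodup : L.Nodup := Finset.nodup_toList _
  -- Lemma A5.4: `θ^{|I|} ∧ w = |I|!·c_I·E_I ∧ w`
  have hannih : ∀ q ∈ P₀, E q * w = 0 := fun q hq =>
    E_mul_wL P₀ s L hq (Finset.mem_toList.mpr (Finset.mem_univ q))
  rw [theta_pow_card_mul c P₀ w hannih, map_smul, mul_smul_comm, map_smul, smul_eq_mul]
  -- `E_I ∧ w = ∏ F p`, and `cop` of it is the main term plus a bad part
  have hprod : ET (Finset.univ \ P₀) * w = (L.map (F P₀ s)).prod := by
    rw [prod_map_F P₀ s L hLnodup, TL_univ]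
  have hmain := cop_prod_sub_main_mem P₀ s L hLnodup
  rw [TL_univ, Finset.toList_toFinset] at hmain
  rw [hprod, ← sub_add_cancel (cop ((L.map (F P₀ s)).prod)) (w ᵍ⊗ₜ[ℂ] ET (Finset.univ \ P₀) : AA ι),
    mul_add, map_add, II_pair_K_eq_zero P₀ z c hmain, zero_add, II_pair_tmul,
    integral_theta_pow_mul_ET, if_pos (by rw [Finset.sdiff_sdiff_eq_self (Finset.subset_univ _)]),
    Finset.sdiff_sdiff_eq_self (Finset.subset_univ _)]
  -- bookkeeping of the constants: `c_I · c_{P₀} = c_𝒫`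
  have hc : (∏ p ∈ Finset.univ \ P₀, c p) * ∏ p ∈ P₀, c p = ∏ p, c p :=
    Finset.prod_sdiff (Finset.subset_univ _)
  rw [← hc]
  ring

end Pairing

end Summit.Ventures.HodgeRepro2.WeilPairing
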